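import Summits.QuantumFields.BalabanUV.T4Continuum.Support.RegionStarTrace
import Summits.QuantumFields.BalabanUV.T4Continuum.Support.AlignedCarrierTrace

/-!
# T⁴ programme, spine node NE2 (U1a), sub-row Δ1 «NE2⁰-Dirichlet» — THE VALUE TRACE ON THE TWO OWN-DIRECTION WALL LAYERS OF A
# CARRIER WITH COLUMNS (scalar form of leaf-06-g6's spike trace, both walls): `n·Σ_{wall} |z|² ≤ 2‖z‖² + Σ_{ν-pairs inside} |∂_ν z|²`

NE2 formalisation swarm `b2b-balaban-t4-ne2-formalise-*`, LEAF PROVER 03 (gen 8), item «W3-GAFFNEY-PAIRING» = (P-gaffney) for the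
LOCAL operator (owner ruling R35 (c) / O15-c, journal 2026-08-20 l.22128 / l.22472; CLAIM l.22258), file P3b (input of P3, the NEUMANN
direction of the pairing).

WHY.  In its own direction `ν` the star carrier `T_ν = Ω ∪ (Ω − e_ν)` of component `ν` (P1's `starSite`) has two wall layers: the
INWARD spikes (`y ∈ T`, `y − e_ν ∉ T`: the deficient layer, outside `Ω`) and the OUTWARD tops (`y ∈ T`, `y + e_ν ∉ T`: the last layer of
`Ω`).  The electric operator is NEUMANN there (no zero-extension wall), so the two-level pairing in direction `ν` (P3) meets the VALUES of
the fine field on these layers — with the factor `n′²` of a second difference — and the only smallness available is the value trace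
`Σ_{wall}|z|² ≤ (2‖z‖² + Σ|∂_ν z|²_{inside})/n` (ℓ²-mass + INTERIOR gradient energy; no Hessian can help: a Neumann solution is `O(1)` on
its free face).  leaf-06-g6's `RegionStarTrace.trace_deficient_le` is this inequality for the inward spikes of a star-bond field; THIS FILE
states it for a scalar field and an ARBITRARY carrier predicate `P` with columns, for BOTH walls, with the own-direction interior
gradient only:

 * §1 `gradOn P ν z := Σ_{x : P x ∧ P (x + e_ν)} ‖(∂_ν z)(x)‖²` (the Neumann-masked `ν`-gradient energy on `P`);
 * §2 **`trace_top_le`**: if every top `y` (`P y`, `¬P (y + e_ν)`) has the downward column `y − i·e_ν ∈ P` (`i < n`), then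
   `n·Σ_{top} ‖z y‖² ≤ 2·nsq z + gradOn P ν z`; **`trace_bottom_le`**: the mirror statement for bottoms (`P y`, `¬P (y − e_ν)`, upward
   columns) — leaf-06-g6's `path_avg` BY NAME + the column injectivity, which follows from the column property alone;
 * §3 THE STAR CARRIER (any region `S`, any level): `starSite_col_top` / `starSite_col_bottom` (gan24's `dvd_succ_of_boundary_bwd` /
   `blockReg_sub_tstep` / `dvd_of_boundary_fwd` / `blockReg_add_tstep`), hence **`trace_top_starSite`** / **`trace_bottom_starSite`**.

HONEST FRAMING (T4-DAG p. 1).  [folklore] finite lattice calculus; nothing printed is a hypothesis or a conclusion; no NE2 statement is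
proved here; (P-W) / (L) / `hinjK` / W3 on boxes OPEN; NE2 (U1a) NOT proved; spine PROVED 0/9 unchanged; NOT [B9] (3.16)/(3.23)–(3.27)
as printed; NOT infinite volume, NOT a mass gap, NOT the Clay problem, NOT summit progress.  HONEST DEPENDENCY: continuum YM on T⁴ ⇐
BetaPertH ∧ nine spine estimates (0/9 proved); BetaPertH ⇐ (D1) ∧ (D4) ∧ CAP+tail; G-an2-4 gates asym, D1 and NE2/3/4.  No `sorry`.
-/

noncomputable section

open scoped BigOperators ComplexConjugate Matrix
open Finset

namespace Summit.QuantumFields.BalabanUV.T4Continuum.CarrierColumnTrace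

open Literature.MathematicalPhysics.QuantumFieldTheory.Balaban1983to89.B5Prop11Plancherel (Tor fine unitVec)
open Literature.MathematicalPhysics.QuantumFieldTheory.Balaban1983to89.B5Action121 (sdiff sdiff_mulVec)
open Literature.MathematicalPhysics.QuantumFieldTheory.Balaban1983to89.B5Prop11Lower (nsq nsq_nonneg)
open Literature.MathematicalPhysics.QuantumFieldTheory.Balaban1983to89.B5Block118 (tstep tstep_zero tstep_succ)
open Summit.QuantumFields.BalabanUV.Beta.GAN24.DirichletBoxTrace (blockReg dvd_of_boundary_fwd dvd_succ_of_boundary_bwd blockReg_add_tstep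
  blockReg_sub_tstep)
open Summit.QuantumFields.BalabanUV.T4Continuum.VectorBlockTrialForm (tstep_add)
open Summit.QuantumFields.BalabanUV.T4Continuum.RegionStarTrace (path_avg)
open Summit.QuantumFields.BalabanUV.T4Continuum.AlignedCarrierTrace (starSite starSite_iff)

variable {d : ℕ} (n : ℕ) [NeZero n] (M : Fin d → ℕ) [hM : ∀ μ, NeZero (M μ)]

/-! ## §1 The Neumann-masked own-direction gradient energy -/

/-- the `ν`-gradient energy over the `ν`-pairs INSIDE the carrier: `Σ_{x : P x ∧ P (x + e_ν)} ‖(∂_ν z)(x)‖²`. [folklore] -/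
def gradOn (P : Tor (fine n M) → Prop) [DecidablePred P] (ν : Fin d) (z : Tor (fine n M) → ℂ) : ℝ :=
  ∑ x ∈ univ.filter (fun x => P x ∧ P (x + unitVec (fine n M) ν)), ‖(sdiff (fine n M) (n : ℂ) ν *ᵥ z) x‖ ^ 2

/-- `0 ≤ gradOn`. [folklore] -/
theorem gradOn_nonneg (P : Tor (fine n M) → Prop) [DecidablePred P] (ν : Fin d) (z : Tor (fine n M) → ℂ) : 0 ≤ gradOn n M P ν z :=
  Finset.sum_nonneg fun _ _ => sq_nonneg _

/-- `gradOn` is at most the full `ν`-gradient energy. [folklore] -/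
theorem gradOn_le_nsq (P : Tor (fine n M) → Prop) [DecidablePred P] (ν : Fin d) (z : Tor (fine n M) → ℂ) :
    gradOn n M P ν z ≤ nsq (sdiff (fine n M) (n : ℂ) ν *ᵥ z) :=
  Finset.sum_le_sum_of_subset_of_nonneg (Finset.filter_subset _ _) fun _ _ _ => sq_nonneg _

/-! ## §2 The value trace on the two wall layers -/

section Walls

variable {n M}
variable {P : Tor (fine n M) → Prop} [DecidablePred P] {ν : Fin d}

omit [NeZero n] hM in
/-- column arithmetic: `y − (s+1)·e + e = y − s·e`. [folklore] -/
theorem sub_tstep_add_unitVec (y : Tor (fine n M)) (s : ℕ) :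
    y - tstep (fine n M) ν (s + 1) + unitVec (fine n M) ν = y - tstep (fine n M) ν s := by
  rw [tstep_succ]; abel

omit [NeZero n] hM in
/-- column arithmetic, upward: `y + s·e + e = y + (s+1)·e`. [folklore] -/
theorem add_tstep_add_unitVec (y : Tor (fine n M)) (s : ℕ) :
    y + tstep (fine n M) ν s + unitVec (fine n M) ν = y + tstep (fine n M) ν (s + 1) := by
  rw [tstep_succ]; abel

omit [NeZero n] hM [DecidablePred P] in
/-- **injectivity of the downward columns of the tops** (from the column property alone): if two tops' columns meet, the tops and
the heights coincide. [folklore] -/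
theorem top_column_inj (hcol : ∀ y, P y → ¬ P (y + unitVec (fine n M) ν) → ∀ i, i < n → P (y - tstep (fine n M) ν i))
    {y y' : Tor (fine n M)} (hy : P y ∧ ¬ P (y + unitVec (fine n M) ν)) (hy' : P y' ∧ ¬ P (y' + unitVec (fine n M) ν))
    {s s' : ℕ} (hs : s < n) (hs' : s' < n) (h : y - tstep (fine n M) ν s = y' - tstep (fine n M) ν s') : y = y' ∧ s = s' := by
  -- if `s < s′` then `y + e = y′ − (s′ − s − 1)e ∈ P`, contradiction; symmetrically
  rcases lt_trichotomy s s' with hlt | heq | hgt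
  · exfalso
    have e1 : y = y' - tstep (fine n M) ν (s' - s) := by
      have : s' = s + (s' - s) := by omega
      rw [this, tstep_add] at h
      have h2 := congrArg (· + tstep (fine n M) ν s) h
      simp only [sub_add_cancel] at h2
      rw [h2]; abel
    have e2 : y + unitVec (fine n M) ν = y' - tstep (fine n M) ν (s' - s - 1) := by
      have ht : s' - s = (s' - s - 1) + 1 := by omega
      rw [e1]; conv_lhs => rw [ht]
      rw [sub_tstep_add_unitVec]
    exact hy.2 (e2 ▸ hcol y' hy'.1 hy'.2 (s' - s - 1) (by omega))
  · subst heq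
    exact ⟨sub_left_injective h, rfl⟩
  · exfalso
    have e1 : y' = y - tstep (fine n M) ν (s - s') := by
      have : s = s' + (s - s') := by omega
      rw [this, tstep_add] at h
      have h2 := congrArg (· + tstep (fine n M) ν s') h
      simp only [sub_add_cancel] at h2
      rw [← h2]; abel
    have e2 : y' + unitVec (fine n M) ν = y - tstep (fine n M) ν (s - s' - 1) := by
      have ht : s - s' = (s - s' - 1) + 1 := by omega
      rw [e1]; conv_lhs => rw [ht]
      rw [sub_tstep_add_unitVec]
    exact hy'.2 (e2 ▸ hcol y hy.1 hy.2 (s - s' - 1) (by omega))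

omit [NeZero n] hM [DecidablePred P] in
/-- **injectivity of the upward columns of the bottoms.** [folklore] -/
theorem bottom_column_inj (hcol : ∀ y, P y → ¬ P (y - unitVec (fine n M) ν) → ∀ i, i < n → P (y + tstep (fine n M) ν i))
    {y y' : Tor (fine n M)} (hy : P y ∧ ¬ P (y - unitVec (fine n M) ν)) (hy' : P y' ∧ ¬ P (y' - unitVec (fine n M) ν))
    {s s' : ℕ} (hs : s < n) (hs' : s' < n) (h : y + tstep (fine n M) ν s = y' + tstep (fine n M) ν s') : y = y' ∧ s = s' := by
  rcases lt_trichotomy s s' with hlt | heq | hgt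
  · exfalso
    have e1 : y = y' + tstep (fine n M) ν (s' - s) := by
      have : s' = s + (s' - s) := by omega
      rw [this, tstep_add] at h
      have h2 := congrArg (· - tstep (fine n M) ν s) h
      simp only [add_sub_cancel_right] at h2
      rw [h2]; abel
    have e2 : y - unitVec (fine n M) ν = y' + tstep (fine n M) ν (s' - s - 1) := by
      have ht : s' - s = (s' - s - 1) + 1 := by omega
      rw [e1]; conv_lhs => rw [ht]
      rw [← add_tstep_add_unitVec, add_sub_cancel_right]
    exact hy.2 (e2 ▸ hcol y' hy'.1 hy'.2 (s' - s - 1) (by omega))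
  · subst heq
    exact ⟨add_right_cancel h, rfl⟩
  · exfalso
    have e1 : y' = y + tstep (fine n M) ν (s - s') := by
      have : s = s' + (s - s') := by omega
      rw [this, tstep_add] at h
      have h2 := congrArg (· - tstep (fine n M) ν s') h
      simp only [add_sub_cancel_right] at h2
      rw [← h2]; abel
    have e2 : y' - unitVec (fine n M) ν = y + tstep (fine n M) ν (s - s' - 1) := by
      have ht : s - s' = (s - s' - 1) + 1 := by omega
      rw [e1]; conv_lhs => rw [ht]
      rw [← add_tstep_add_unitVec, add_sub_cancel_right]
    exact hy'.2 (e2 ▸ hcol y hy.1 hy.2 (s - s' - 1) (by omega))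

/-- summing a non-negative site function over the columns of the tops counts every site at most once. [folklore] -/
theorem sum_top_columns_le (hcol : ∀ y, P y → ¬ P (y + unitVec (fine n M) ν) → ∀ i, i < n → P (y - tstep (fine n M) ν i))
    (F : Tor (fine n M) → ℝ) (hF : ∀ x, 0 ≤ F x) (m : ℕ) (hm : m ≤ n) :
    ∑ y ∈ univ.filter (fun y => P y ∧ ¬ P (y + unitVec (fine n M) ν)), ∑ s ∈ range m, F (y - tstep (fine n M) ν s) ≤ ∑ x, F x := by
  set Tp := univ.filter (fun y => P y ∧ ¬ P (y + unitVec (fine n M) ν)) with hTp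
  have hinj : Set.InjOn (fun p : Tor (fine n M) × ℕ => p.1 - tstep (fine n M) ν p.2) ↑(Tp ×ˢ range m) := by
    rintro ⟨y, s⟩ hys ⟨y', s'⟩ hys' h
    rw [Finset.coe_product, Set.mem_prod, Finset.mem_coe, Finset.mem_coe, mem_range] at hys hys'
    have hy := (Finset.mem_filter.mp hys.1).2
    have hy' := (Finset.mem_filter.mp hys'.1).2
    obtain ⟨h1, h2⟩ := top_column_inj hcol hy hy' (by omega) (by omega) h
    exact Prod.ext h1 h2
  rw [← sum_product (s := Tp) (t := range m) (f := fun p => F (p.1 - tstep (fine n M) ν p.2)),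
    ← sum_image (f := F) (g := fun p : Tor (fine n M) × ℕ => p.1 - tstep (fine n M) ν p.2) hinj]
  exact sum_le_sum_of_subset_of_nonneg (subset_univ _) fun c _ _ => hF c

/-- the same, restricted to a target sub-family: if every column site of height `< m` satisfies `Q`, the column sum is at most the
sum over `Q`. [folklore] -/
theorem sum_top_columns_le_filter (hcol : ∀ y, P y → ¬ P (y + unitVec (fine n M) ν) → ∀ i, i < n → P (y - tstep (fine n M) ν i))
    (F : Tor (fine n M) → ℝ) (hF : ∀ x, 0 ≤ F x) (m : ℕ) (hm : m ≤ n) (Q : Tor (fine n M) → Prop) [DecidablePred Q]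
    (hQ : ∀ y, P y → ¬ P (y + unitVec (fine n M) ν) → ∀ s, s < m → Q (y - tstep (fine n M) ν s)) :
    ∑ y ∈ univ.filter (fun y => P y ∧ ¬ P (y + unitVec (fine n M) ν)), ∑ s ∈ range m, F (y - tstep (fine n M) ν s)
      ≤ ∑ x ∈ univ.filter Q, F x := by
  have h := sum_top_columns_le hcol (fun x => if Q x then F x else 0) (fun x => ite_nonneg (hF x) le_rfl) m hm
  rw [← Finset.sum_filter] at h
  refine le_trans (le_of_eq (Finset.sum_congr rfl fun y hy => Finset.sum_congr rfl fun s hs => ?_)) h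
  obtain ⟨hy1, hy2⟩ := (Finset.mem_filter.mp hy).2
  rw [if_pos (hQ y hy1 hy2 s (mem_range.mp hs))]

/-- summing a non-negative site function over the columns of the bottoms counts every site at most once (filtered form). [folklore] -/
theorem sum_bottom_columns_le_filter (hcol : ∀ y, P y → ¬ P (y - unitVec (fine n M) ν) → ∀ i, i < n → P (y + tstep (fine n M) ν i))
    (F : Tor (fine n M) → ℝ) (hF : ∀ x, 0 ≤ F x) (m : ℕ) (hm : m ≤ n) (Q : Tor (fine n M) → Prop) [DecidablePred Q]
    (hQ : ∀ y, P y → ¬ P (y - unitVec (fine n M) ν) → ∀ s, s < m → Q (y + tstep (fine n M) ν s)) :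
    ∑ y ∈ univ.filter (fun y => P y ∧ ¬ P (y - unitVec (fine n M) ν)), ∑ s ∈ range m, F (y + tstep (fine n M) ν s)
      ≤ ∑ x ∈ univ.filter Q, F x := by
  set Bt := univ.filter (fun y => P y ∧ ¬ P (y - unitVec (fine n M) ν)) with hBt
  have hinj : Set.InjOn (fun p : Tor (fine n M) × ℕ => p.1 + tstep (fine n M) ν p.2) ↑(Bt ×ˢ range m) := by
    rintro ⟨y, s⟩ hys ⟨y', s'⟩ hys' h
    rw [Finset.coe_product, Set.mem_prod, Finset.mem_coe, Finset.mem_coe, mem_range] at hys hys'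
    have hy := (Finset.mem_filter.mp hys.1).2
    have hy' := (Finset.mem_filter.mp hys'.1).2
    obtain ⟨h1, h2⟩ := bottom_column_inj hcol hy hy' (by omega) (by omega) h
    exact Prod.ext h1 h2
  set G : Tor (fine n M) → ℝ := fun x => if Q x then F x else 0 with hG
  have hG0 : ∀ x, 0 ≤ G x := fun x => by simp only [hG]; exact ite_nonneg (hF x) le_rfl
  have h1 : ∑ y ∈ Bt, ∑ s ∈ range m, F (y + tstep (fine n M) ν s) = ∑ y ∈ Bt, ∑ s ∈ range m, G (y + tstep (fine n M) ν s) := by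
    refine Finset.sum_congr rfl fun y hy => Finset.sum_congr rfl fun s hs => ?_
    obtain ⟨hy1, hy2⟩ := (Finset.mem_filter.mp hy).2
    simp only [hG, if_pos (hQ y hy1 hy2 s (mem_range.mp hs))]
  rw [h1, ← sum_product (s := Bt) (t := range m) (f := fun p => G (p.1 + tstep (fine n M) ν p.2)),
    ← sum_image (f := G) (g := fun p : Tor (fine n M) × ℕ => p.1 + tstep (fine n M) ν p.2) hinj]
  refine (sum_le_sum_of_subset_of_nonneg (subset_univ _) fun c _ _ => hG0 c).trans (le_of_eq ?_)
  rw [hG, Finset.sum_filter]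

/-- **THE VALUE TRACE ON THE TOPS**: if every top has its downward column of `n` sites in `P`, then
`n·Σ_{y : P y, ¬P(y+e_ν)} ‖z y‖² ≤ 2·nsq z + gradOn P ν z`. [folklore] -/
theorem trace_top_le (hcol : ∀ y, P y → ¬ P (y + unitVec (fine n M) ν) → ∀ i, i < n → P (y - tstep (fine n M) ν i))
    (z : Tor (fine n M) → ℂ) :
    (n : ℝ) * ∑ y ∈ univ.filter (fun y => P y ∧ ¬ P (y + unitVec (fine n M) ν)), ‖z y‖ ^ 2 ≤ 2 * nsq z + gradOn n M P ν z := by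
  have hn1 : 1 ≤ n := Nat.pos_of_ne_zero (NeZero.ne n)
  set Tp := univ.filter (fun y => P y ∧ ¬ P (y + unitVec (fine n M) ν)) with hTp
  set D := sdiff (fine n M) (n : ℂ) ν with hD
  -- pointwise: `path_avg` along the downward column
  have hpt : ∀ y ∈ Tp, (n : ℝ) * ‖z y‖ ^ 2 ≤ 2 * ∑ s ∈ range n, ‖z (y - tstep (fine n M) ν s)‖ ^ 2
      + ∑ r ∈ range (n - 1), ‖(D *ᵥ z) (y - tstep (fine n M) ν (r + 1))‖ ^ 2 := by
    intro y _
    have h := path_avg (fun s => z (y - tstep (fine n M) ν s)) n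
    simp only [tstep_zero, sub_zero] at h
    refine h.trans (add_le_add le_rfl (le_of_eq ?_))
    rw [Finset.mul_sum]
    refine Finset.sum_congr rfl fun r _ => ?_
    rw [hD, sdiff_mulVec, sub_tstep_add_unitVec, norm_mul, Complex.norm_natCast, mul_pow, ← norm_neg, neg_sub]
  -- sum the two column families
  have hA : ∑ y ∈ Tp, ∑ s ∈ range n, ‖z (y - tstep (fine n M) ν s)‖ ^ 2 ≤ nsq z :=
    sum_top_columns_le hcol (fun x => ‖z x‖ ^ 2) (fun _ => sq_nonneg _) n le_rfl
  have hB : ∑ y ∈ Tp, ∑ r ∈ range (n - 1), ‖(D *ᵥ z) (y - tstep (fine n M) ν (r + 1))‖ ^ 2 ≤ gradOn n M P ν z := by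
    -- re-index `r + 1 ↦ s ∈ [1, n)`, enlarge to `range n` minus nothing harmful: use the filtered column lemma with `m = n`
    -- applied to `F = 𝟙[1 ≤ ·]`-free form: every column site of height `s+1 ≤ n−1` is a ν-pair inside `P`
    have h1 : ∀ y ∈ Tp, ∑ r ∈ range (n - 1), ‖(D *ᵥ z) (y - tstep (fine n M) ν (r + 1))‖ ^ 2
        ≤ ∑ s ∈ range n, (if (P (y - tstep (fine n M) ν s) ∧ P (y - tstep (fine n M) ν s + unitVec (fine n M) ν)
            ∧ 1 ≤ s) then ‖(D *ᵥ z) (y - tstep (fine n M) ν s)‖ ^ 2 else 0) := by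
      intro y hy
      obtain ⟨hy1, hy2⟩ := (Finset.mem_filter.mp hy).2
      have e : ∑ r ∈ range (n - 1), ‖(D *ᵥ z) (y - tstep (fine n M) ν (r + 1))‖ ^ 2
          = ∑ s ∈ Ico 1 n, ‖(D *ᵥ z) (y - tstep (fine n M) ν s)‖ ^ 2 := by
        rw [Finset.sum_Ico_eq_sum_range]
        exact Finset.sum_congr rfl fun r _ => by rw [add_comm]
      rw [e, ← Finset.sum_filter]
      refine Finset.sum_le_sum_of_subset_of_nonneg (fun s hs => ?_) fun _ _ _ => sq_nonneg _
      have hs := Finset.mem_Ico.mp hs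
      refine Finset.mem_filter.mpr ⟨mem_range.mpr hs.2, ?_, ?_, hs.1⟩
      · exact hcol y hy1 hy2 s hs.2
      · have : s = (s - 1) + 1 := by omega
        rw [this, sub_tstep_add_unitVec]
        exact hcol y hy1 hy2 (s - 1) (by omega)
    refine (Finset.sum_le_sum h1).trans ?_
    have h2 := sum_top_columns_le hcol
      (fun x => if (P x ∧ P (x + unitVec (fine n M) ν)) then ‖(D *ᵥ z) x‖ ^ 2 else 0)
      (fun x => ite_nonneg (sq_nonneg _) le_rfl) n le_rfl
    refine le_trans (Finset.sum_le_sum fun y _ => Finset.sum_le_sum fun s _ => ?_) (h2.trans (le_of_eq ?_))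
    · by_cases hc : P (y - tstep (fine n M) ν s) ∧ P (y - tstep (fine n M) ν s + unitVec (fine n M) ν)
      · by_cases h1s : 1 ≤ s
        · rw [if_pos ⟨hc.1, hc.2, h1s⟩, if_pos hc]
        · rw [if_neg (fun h => h1s h.2.2), if_pos hc]; exact sq_nonneg _
      · rw [if_neg (fun h => hc ⟨h.1, h.2.1⟩), if_neg hc]
    · rw [gradOn, Finset.sum_filter]
  have hsum := Finset.sum_le_sum hpt
  rw [← Finset.mul_sum, Finset.sum_add_distrib, ← Finset.mul_sum] at hsum
  linarith

/-- **THE VALUE TRACE ON THE BOTTOMS**: if every bottom has its upward column of `n` sites in `P`, then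
`n·Σ_{y : P y, ¬P(y−e_ν)} ‖z y‖² ≤ 2·nsq z + gradOn P ν z`. [folklore] -/
theorem trace_bottom_le (hcol : ∀ y, P y → ¬ P (y - unitVec (fine n M) ν) → ∀ i, i < n → P (y + tstep (fine n M) ν i))
    (z : Tor (fine n M) → ℂ) :
    (n : ℝ) * ∑ y ∈ univ.filter (fun y => P y ∧ ¬ P (y - unitVec (fine n M) ν)), ‖z y‖ ^ 2 ≤ 2 * nsq z + gradOn n M P ν z := by
  have hn1 : 1 ≤ n := Nat.pos_of_ne_zero (NeZero.ne n)
  set Bt := univ.filter (fun y => P y ∧ ¬ P (y - unitVec (fine n M) ν)) with hBt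
  set D := sdiff (fine n M) (n : ℂ) ν with hD
  have hpt : ∀ y ∈ Bt, (n : ℝ) * ‖z y‖ ^ 2 ≤ 2 * ∑ s ∈ range n, ‖z (y + tstep (fine n M) ν s)‖ ^ 2
      + ∑ r ∈ range (n - 1), ‖(D *ᵥ z) (y + tstep (fine n M) ν r)‖ ^ 2 := by
    intro y _
    have h := path_avg (fun s => z (y + tstep (fine n M) ν s)) n
    simp only [tstep_zero, add_zero] at h
    refine h.trans (add_le_add le_rfl (le_of_eq ?_))
    rw [Finset.mul_sum]
    refine Finset.sum_congr rfl fun r _ => ?_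
    rw [hD, sdiff_mulVec, add_tstep_add_unitVec, norm_mul, Complex.norm_natCast, mul_pow]
  have hA : ∑ y ∈ Bt, ∑ s ∈ range n, ‖z (y + tstep (fine n M) ν s)‖ ^ 2 ≤ nsq z := by
    have h := sum_bottom_columns_le_filter hcol (fun x => ‖z x‖ ^ 2) (fun _ => sq_nonneg _) n le_rfl (fun _ => True)
      (fun _ _ _ _ _ => trivial)
    rw [Finset.filter_true_of_mem (fun _ _ => trivial)] at h
    exact h
  have hB : ∑ y ∈ Bt, ∑ r ∈ range (n - 1), ‖(D *ᵥ z) (y + tstep (fine n M) ν r)‖ ^ 2 ≤ gradOn n M P ν z := by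
    have h := sum_bottom_columns_le_filter hcol (fun x => ‖(D *ᵥ z) x‖ ^ 2) (fun _ => sq_nonneg _) (n - 1) (Nat.sub_le n 1)
      (fun x => P x ∧ P (x + unitVec (fine n M) ν)) (fun y hy1 hy2 s hs => ⟨hcol y hy1 hy2 s (by omega), by
        rw [add_tstep_add_unitVec]; exact hcol y hy1 hy2 (s + 1) (by omega)⟩)
    exact h
  have hsum := Finset.sum_le_sum hpt
  rw [← Finset.mul_sum, Finset.sum_add_distrib, ← Finset.mul_sum] at hsum
  linarith

end Walls

/-! ## §3 The star carrier of a component in its own direction -/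

section Star

variable (S : Tor M → Prop) [DecidablePred S]

omit [DecidablePred S] in
/-- the TOPS of the star carrier have downward columns: `y ∈ T_ν`, `y + e_ν ∉ T_ν` ⟹ `y ∈ Ω` on the last `ν`-layer of its block, so
`y − i·e_ν ∈ Ω ⊆ T_ν` for `i < n`. [folklore] -/
theorem starSite_col_top (ν : Fin d) :
    ∀ y, starSite n M S ν y → ¬ starSite n M S ν (y + unitVec (fine n M) ν) → ∀ i, i < n → starSite n M S ν (y - tstep (fine n M) ν i) := by
  intro y hy hy' i hi
  rw [starSite_iff] at hy hy' ⊢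
  push Not at hy'
  have hΩ : blockReg n M S y := hy.resolve_right hy'.1
  exact Or.inl (blockReg_sub_tstep n M S hΩ (dvd_succ_of_boundary_bwd n M S hΩ hy'.1) hi)

omit [DecidablePred S] in
/-- the BOTTOMS of the star carrier have upward columns: `y ∈ T_ν`, `y − e_ν ∉ T_ν` ⟹ `y ∉ Ω`, `y + e_ν ∈ Ω` on the first `ν`-layer
of its block, so `y + i·e_ν ∈ T_ν` for `i < n`. [folklore] -/
theorem starSite_col_bottom (ν : Fin d) :
    ∀ y, starSite n M S ν y → ¬ starSite n M S ν (y - unitVec (fine n M) ν) → ∀ i, i < n → starSite n M S ν (y + tstep (fine n M) ν i) := by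
  intro y hy hy' i hi
  rw [starSite_iff] at hy'
  push Not at hy'
  have hyΩ : ¬ blockReg n M S y := by rw [sub_add_cancel] at hy'; exact hy'.2
  have hup : blockReg n M S (y + unitVec (fine n M) ν) := ((starSite_iff n M S ν y).mp hy).resolve_left hyΩ
  have hdvd : n ∣ ((y + unitVec (fine n M) ν) ν).val :=
    dvd_of_boundary_fwd n M S hup (by rw [add_sub_cancel_right]; exact hyΩ)
  rcases Nat.eq_zero_or_pos i with h0 | hpos
  · subst h0; rw [tstep_zero, add_zero]; exact hy
  · rw [starSite_iff]
    left
    have e : y + tstep (fine n M) ν i = (y + unitVec (fine n M) ν) + tstep (fine n M) ν (i - 1) := by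
      have : i = (i - 1) + 1 := by omega
      conv_lhs => rw [this]
      rw [← add_tstep_add_unitVec]; abel
    rw [e]
    exact blockReg_add_tstep n M S hup hdvd (by omega)

/-- **VALUE TRACE ON THE TOPS OF THE STAR CARRIER** (any region, any level):
`n·Σ_{y ∈ T_ν, y+e_ν ∉ T_ν} ‖z y‖² ≤ 2·nsq z + gradOn T_ν ν z`. [folklore] -/
theorem trace_top_starSite (ν : Fin d) (z : Tor (fine n M) → ℂ) :
    (n : ℝ) * ∑ y ∈ univ.filter (fun y => starSite n M S ν y ∧ ¬ starSite n M S ν (y + unitVec (fine n M) ν)), ‖z y‖ ^ 2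
      ≤ 2 * nsq z + gradOn n M (starSite n M S ν) ν z :=
  trace_top_le (starSite_col_top n M S ν) z

/-- **VALUE TRACE ON THE BOTTOMS (INWARD SPIKES) OF THE STAR CARRIER** (any region, any level):
`n·Σ_{y ∈ T_ν, y−e_ν ∉ T_ν} ‖z y‖² ≤ 2·nsq z + gradOn T_ν ν z` (scalar form of leaf-06-g6's `trace_deficient_le`, own direction only). [folklore] -/
theorem trace_bottom_starSite (ν : Fin d) (z : Tor (fine n M) → ℂ) :
    (n : ℝ) * ∑ y ∈ univ.filter (fun y => starSite n M S ν y ∧ ¬ starSite n M S ν (y - unitVec (fine n M) ν)), ‖z y‖ ^ 2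
      ≤ 2 * nsq z + gradOn n M (starSite n M S ν) ν z :=
  trace_bottom_le (starSite_col_bottom n M S ν) z

end Star

end Summit.QuantumFields.BalabanUV.T4Continuum.CarrierColumnTrace

end
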